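import Summits.BirchSwinnertonDyer.Rank1Residual.O5.SignedLevelRaisingTransferThree
import HarnessLib

/-!
# O5 at `p = 3`: kernel READINGS of the signed level-raising transfer T-O5-JP (cc-typer-5 GEN 14, A-O5-JP0)

HONEST FRAMING (cell `b2b-bsdres`, class O5 = `9 ∥ N`, tame potentially supersingular, analytic rank `≤ 1`; lane
CLASS-CLOSURE): research route; no claim beyond the stated classes; census numbers are EVIDENCE, never Literature facts;
nothing here moves a RESIDUAL-MAP mark; O5 stays OPEN.  THEOREMS ONLY (no definition, no named fact, no conjecture node;
net named-fact debt `0`).  The node file `O5/SignedLevelRaisingTransferThree.lean` (o5-r2 GEN 11, placed by this seat)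
is not touched.

## What this file does

The JPC3 census cells quoted in the docstring of `SignedLevelRaisingTransferThree` are read there on the BSD side
(`Ш_an`, Cremona).  Here they are derived on the SELMER side from the node taken as a DISPLAYED hypothesis
`(hJP : SignedLevelRaisingTransferThree)` and the tree's exact descent count `#Sel₃ = 3^{rank}·#E(ℚ)[3]·#Ш[3]`
(`WeierstrassCurve.natCard_selmerGroup_eq`, Silverman X.4.2), with the classical inputs displayed by name exactly as in
`O5/CrudeTransferReadings.lean`: `#G(ℚ)[3] = 1` (automatic from `ρ̄_G ≅ ρ̄_C` irreducible — Brauer–Nesbitt + Chebotarev,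
not a tree theorem), `Ш` finite where an order is read, the Cassels–Tate pairing (registry A24) where a parity is read.

* §1 `selmerDimThree_eq_mordellWeilRank_of_not_three_dvd_shaOrder` (`dim Sel₃ = rank` on unit-`Ш` curves without
  rational `3`-torsion), `mordellWeilRank_eq_zero_of_selmerDimThree_eq_zero`,
  `natCard_shaThreeTorsion_eq_one_of_selmerDimThree_eq_zero`, `nine_dvd_shaOrder_of_selmerDimThree_eq_two`,
  **`locallyThreeDivisibleAt_of_rank_zero`** (at rank `0` without rational `3`-torsion DIV holds: Mordell–Weil ⟹ `E(ℚ)`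
  finite ⟹ `P ↦ 3P` onto), `mordellWeilRank_eq_one_of_selmerDimThree_eq_one` (granted Cassels–Tate).
* §2 the cells: `rank_zero_and_shaThree_trivial_of_signedTransfer` (`r_C = 1 ∧ ¬DIV ⟹ rank G = 0 ∧ Ш(G)[3] = 0`,
  JPC3 1 083/1 083), `selmerDimThree_eq_two_of_signedTransfer_of_div` (`r_C = 1 ∧ DIV ⟹ dim Sel₃(G) = 2`, 20/20),
  `selmerDimThree_eq_one_of_signedTransfer_of_rank_zero` (`r_C = 0 ⟹ dim Sel₃(G) = 1`, 306/306), and the edge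
  `signedLevelRaisingTransferThree_of_sharp` (T-O5-JP♯ ⟹ T-O5-JP granted `μ₃ ⊄ ℚ_q ⟹ h⁰(ℚ_q, C[3]) ≤ 1`).
Nothing is claimed about the node; every theorem displays it (or its conclusion) as a hypothesis.

References: [SilvermanAEC2009] Thm. VIII.6.7, X.4.2, X.4.14, Cor. III.8.1.1; [Mazur1977] III §5; [Dokchitser2013ParityNotes]
§2; node file and `HOME/b2b-bsdres-o5-r2/gen11/jpc3/JPC3-RESULT.md` (EVIDENCE).
-/

noncomputable section

open scoped Classical

open WeierstrassCurve Literature.NumberTheory.EllipticCurves Literature.NumberTheory.EllipticCurves.Rank1Residual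
  Summit.BirchSwinnertonDyer.Rank1Residual.Additive

namespace Summit.BirchSwinnertonDyer.Rank1Residual.O5

/-! ## §1 Selmer-dimension bookkeeping -/

section Readings

variable (C : WeierstrassCurve ℚ) [C.IsElliptic]

/-- **`dim Sel₃(E) = rank E(ℚ)` on unit-`Ш` curves without rational `3`-torsion**: `Ш(E)` finite with `3 ∤ #Ш(E)`
(so `Ш(E)[3]`, a `3`-group whose order divides `#Ш(E)`, is trivial) and `#E(ℚ)[3] = 1`; then the descent count reads
`3^{dim} = 3^{rank}`.  (The rank-`0` case is `selmerDimThree_eq_zero_of_rank_zero` of `CrudeTransferReadings`.)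
[cite: SilvermanAEC2009, Thm. X.4.2] -/
theorem selmerDimThree_eq_mordellWeilRank_of_not_three_dvd_shaOrder (hfin : C.ShaFinite)
    (h3 : ¬ 3 ∣ C.shaOrder) (htors : Nat.card (AddSubgroup.torsionBy C.toAffine.Point 3) = 1) :
    selmerDimThree C = C.mordellWeilRank := by
  haveI : Finite C.sha := hfin
  haveI : Fact (Nat.Prime 3) := ⟨Nat.prime_three⟩
  have h := C.natCard_selmerGroup_eq (n := 3) (by norm_num)
  rw [Nat.cast_ofNat] at h
  set T : AddSubgroup C.galH1 := C.sha ⊓ AddSubgroup.torsionBy C.galH1 3 with hT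
  -- `#T` is a power of `3` dividing `#Ш(C)`, so it is `1`
  have hTle : T ≤ C.sha := inf_le_left
  have hTdvd : Nat.card T ∣ C.shaOrder := AddSubgroup.card_dvd_of_le hTle
  haveI : Finite T := Finite.of_injective (AddSubgroup.inclusion hTle) (AddSubgroup.inclusion_injective hTle)
  have hTpow : ∃ k : ℕ, Nat.card T = 3 ^ k := by
    refine exists_natCard_eq_pow_of_nsmul_eq_zero 3 fun x ↦ Subtype.ext ?_
    have hx : (3 : ℤ) • (x : C.galH1) = 0 := (x.2).2
    rw [AddSubgroupClass.coe_nsmul, ZeroMemClass.coe_zero, ← natCast_zsmul, Nat.cast_ofNat]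
    exact hx
  obtain ⟨k, hk⟩ := hTpow
  have hk0 : k = 0 := by
    by_contra hk0
    exact h3 ((dvd_pow_self 3 hk0).trans (hk ▸ hTdvd))
  have hT1 : Nat.card T = 1 := by rw [hk, hk0, pow_zero]
  rw [natCard_selmerGroup_three_eq_pow C, hT1, mul_one] at h
  -- `3 ^ dim = 3 ^ rank · #E(ℚ)[3] = 3 ^ rank` (`convert` bridges the decidable-equality instance on `E(ℚ)`)
  have e : 3 ^ selmerDimThree C = 3 ^ C.mordellWeilRank * 1 := by
    convert h using 2
    convert htors.symm
  rw [mul_one] at e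
  exact Nat.pow_right_injective (by norm_num : 2 ≤ 3) e

/-- `dim Sel₃(E) = 0 ⟹ rank E(ℚ) = 0` (Kummer: `rank ≤ dim Sel₃`, `mordellWeilRank_le_selmerDimThree`).
[cite: SilvermanAEC2009, Thm. X.4.2] -/
theorem mordellWeilRank_eq_zero_of_selmerDimThree_eq_zero (h : selmerDimThree C = 0) :
    C.mordellWeilRank = 0 := by
  have := mordellWeilRank_le_selmerDimThree C
  omega

/-- `dim Sel₃(E) = 0 ⟹ Ш(E)[3] = 0` (the descent count with `#Sel₃ = 1`). [cite: SilvermanAEC2009, Thm. X.4.2] -/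
theorem natCard_shaThreeTorsion_eq_one_of_selmerDimThree_eq_zero (h : selmerDimThree C = 0) :
    Nat.card (C.sha ⊓ AddSubgroup.torsionBy C.galH1 3 : AddSubgroup C.galH1) = 1 := by
  have hsel := C.natCard_selmerGroup_eq (n := 3) (by norm_num)
  rw [Nat.cast_ofNat, natCard_selmerGroup_three_eq_pow C, h, pow_zero] at hsel
  exact Nat.eq_one_of_mul_eq_one_left hsel.symm

/-- `dim Sel₃(E) = 2`, `rank E(ℚ) = 0`, `#E(ℚ)[3] = 1` ⟹ `9 ∣ #Ш(E)` (`#Ш(E)[3] = 9` by the descent count; `shaOrder`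
is a `Nat.card`, so for infinite `Ш` the conclusion is the junk-trivial `9 ∣ 0`).  The Selmer-side form of the census
reading "`9 ∥ #Ш_an(G)`" of the DIV cell. [cite: SilvermanAEC2009, Thm. X.4.2] -/
theorem nine_dvd_shaOrder_of_selmerDimThree_eq_two (hs : selmerDimThree C = 2) (hrk : C.mordellWeilRank = 0)
    (htors : Nat.card (AddSubgroup.torsionBy C.toAffine.Point 3) = 1) : 9 ∣ C.shaOrder := by
  have hsel := C.natCard_selmerGroup_eq (n := 3) (by norm_num)
  rw [Nat.cast_ofNat, natCard_selmerGroup_three_eq_pow C, hs, hrk, pow_zero, one_mul] at hsel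
  -- `3 ^ 2 = #E(ℚ)[3] · #Ш[3] = #Ш[3]` (`convert` bridges the decidable-equality instance on `E(ℚ)`)
  have e : 3 ^ 2 = 1 * Nat.card (C.sha ⊓ AddSubgroup.torsionBy C.galH1 3 : AddSubgroup C.galH1) := by
    convert hsel using 2
    convert htors.symm
  rw [show (9 : ℕ) = 3 ^ 2 by norm_num, e, one_mul]
  exact AddSubgroup.card_dvd_of_le inf_le_left

/-- **At rank `0` without rational `3`-torsion every rational point is locally `3`-divisible (DIV holds vacuously on
the Mordell–Weil side)**: `E(ℚ)` is finitely generated (Mordell–Weil, `module_finite_point_holds`) of `ℤ`-rank `0`,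
hence torsion, hence finite; with `E(ℚ)[3] = 0` multiplication by `3` is injective on it, hence onto, so `P = 3·Q'`
with `Q'` rational and `Q := Q'` viewed in `E(ℚ_q)`.  The `r_C = 0` cell therefore always sits on the DIV branch of
the node. [cite: SilvermanAEC2009, Thm. VIII.6.7] -/
theorem locallyThreeDivisibleAt_of_rank_zero (q : ℕ) [Fact q.Prime] (hrk : C.mordellWeilRank = 0)
    (htors : Nat.card (AddSubgroup.torsionBy C.toAffine.Point 3) = 1) : LocallyThreeDivisibleAt C q := by
  -- `E(ℚ)` is finitely generated of rank `0`: torsion, hence finite.  (The group-law instances are those INSIDE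
  -- `mordellWeilRank` / `module_finite_point` — stated for a general field, with classical decidability of `=` on `ℚ`;
  -- they are fed by unification `(_)`, and only the instance-free conclusion `Finite E(ℚ)` leaves this block.)
  haveI : Finite C.toAffine.Point := by
    -- transport Mordell–Weil and `rank = 0` to this file's group-law instance (`convert` bridges the two
    -- `DecidableEq ℚ` instances, a subsingleton), then conclude in one world
    haveI : Module.Finite ℤ C.toAffine.Point := by convert C.module_finite_point_holds
    have hrk' : Module.finrank ℤ C.toAffine.Point = 0 := by
      unfold WeierstrassCurve.mordellWeilRank at hrk
      convert hrk
    exact Module.finite_of_fg_torsion _ (Module.finrank_eq_zero_iff_isTorsion.mp hrk')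
  -- no rational `3`-torsion: `P ↦ 3 • P` is injective on the finite group `E(ℚ)`, hence surjective
  have hbot : AddSubgroup.torsionBy C.toAffine.Point 3 = ⊥ := AddSubgroup.eq_bot_of_card_eq _ htors
  have hinj : Function.Injective (fun P : C.toAffine.Point ↦ (3 : ℕ) • P) := by
    intro a b hab
    have h0 : (3 : ℕ) • (a - b) = 0 := by
      rw [nsmul_sub, sub_eq_zero]
      exact hab
    have h0z : (3 : ℤ) • (a - b) = 0 := by
      rw [show (3 : ℤ) = ((3 : ℕ) : ℤ) from rfl, natCast_zsmul]
      exact h0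
    have hmem : a - b ∈ AddSubgroup.torsionBy C.toAffine.Point 3 :=
      (Submodule.mem_torsionBy_iff (3 : ℤ) (a - b)).mpr h0z
    rw [hbot, AddSubgroup.mem_bot, sub_eq_zero] at hmem
    exact hmem
  have hsurj : Function.Surjective (fun P : C.toAffine.Point ↦ (3 : ℕ) • P) :=
    Finite.surjective_of_injective hinj
  intro P
  obtain ⟨Q', hQ'⟩ := hsurj P
  exact ⟨WeierstrassCurve.Affine.Point.map (W' := C.toAffine) (Algebra.ofId ℚ ℚ_[q]) Q',
    (congrArg (WeierstrassCurve.Affine.Point.map (W' := C.toAffine) (Algebra.ofId ℚ ℚ_[q])) hQ'.symm).trans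
      (map_nsmul _ 3 Q')⟩

/-- **`dim Sel₃(E) = 1`, `#E(ℚ)[3] = 1`, `Ш(E)` finite ⟹ `rank E(ℚ) = 1`, granted the Cassels–Tate pairing (A24)**:
`s = t + corank + 2m` (`exists_selmerRank_eq_add`) with `s = 1`, `t = 0` forces `corank = 1`, `m = 0`, and
`corank = rank + corank Ш = rank` for finite `Ш` (`selmerCorank_eq_mordellWeilRank_add_holds`,
`zpCorank_eq_zero_of_finite`).  The Selmer-side form of the census reading "`r_C = 0 ⟹ r_G = 1`".
[cite: SilvermanAEC2009, Thm. X.4.14] [cite: Dokchitser2013ParityNotes, §2] -/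
theorem mordellWeilRank_eq_one_of_selmerDimThree_eq_one
    (hCT : WeierstrassCurve.exists_casselsTate_pairing (K := ℚ)) (hs : selmerDimThree C = 1) (hfin : C.ShaFinite)
    (htors : Nat.card (AddSubgroup.torsionBy C.toAffine.Point 3) = 1) : C.mordellWeilRank = 1 := by
  haveI : Finite C.sha := hfin
  haveI : Fact (Nat.Prime 3) := ⟨Nat.prime_three⟩
  have ht : Nat.card (AddSubgroup.torsionBy C.toAffine.Point ((3 : ℕ) : ℤ)) = 3 ^ 0 := by
    rw [pow_zero, Nat.cast_ofNat]; exact htors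
  obtain ⟨m, hm⟩ := exists_selmerRank_eq_add hCT C 3 (selmerDimThree C) 0
    (by rw [Nat.cast_ofNat]; exact natCard_selmerGroup_three_eq_pow C) (by convert ht)
  have hsha : C.shaCorank 3 = 0 := zpCorank_eq_zero_of_finite _ 3
  rw [C.selmerCorank_eq_mordellWeilRank_add_holds 3, hsha, hs] at hm
  omega

end Readings

/-! ## §2 The cells of the node -/

/-- **Cell `r_C = 1 ∧ ¬DIV ⟹ (rank G, Ш(G)[3]) = (0, 0)` (JPC3: 1 083/1 083) is a KERNEL consequence of T-O5-JP.**
Under the node's hypotheses with `rank C(ℚ) = 1`: `dim Sel₃(C) = 1` (unit `Ш(C)`, `#C(ℚ)[3] = 1` by irreducibility —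
`natCard_torsionBy_eq_one_of_hasIrreducibleModPGaloisRep`), the `¬DIV` branch gives `dim Sel₃(G) = 0`, whence
`rank G(ℚ) = 0` and `Ш(G)[3] = 0`.  The node enters as the displayed hypothesis `hJP`; nothing is asserted about it.
[cite: SilvermanAEC2009, Thm. X.4.2] [cite: Mazur1977, Ch. III §5, p. 157] -/
theorem rank_zero_and_shaThree_trivial_of_signedTransfer (hJP : SignedLevelRaisingTransferThree)
    (C G : WeierstrassCurve ℚ) [C.IsElliptic] [C.IsGloballyMinimal] [G.IsElliptic] [G.IsGloballyMinimal]
    (q : ℕ) (hq : q.Prime) (hirr : C.HasIrreducibleModPGaloisRep 3) (hcong : IsCongruentModThree C G)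
    (hcls : ClassO5 C 3 ∨ ¬ Addv C 3) (hq3 : q % 3 = 2) (hqN : ¬ (q ∣ C.conductorNorm ℤ))
    (hN : G.conductorNorm ℤ = C.conductorNorm ℤ * q) (hsplit : @IsSplitNodeAt G q ⟨hq⟩)
    (hTC : transversePrimesThree C = ∅) (hTG : transversePrimesThree G ⊆ {q})
    (h0C : @NoLocalThreeTorsionAt C 3 ⟨Nat.prime_three⟩) (h0G : @NoLocalThreeTorsionAt G 3 ⟨Nat.prime_three⟩)
    (hw : C.rootNumberThree = G.rootNumberThree) (hfin : C.ShaFinite) (h3 : ¬ 3 ∣ C.shaOrder)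
    (hrk : C.mordellWeilRank = 1) (hndiv : ¬ @LocallyThreeDivisibleAt C q ⟨hq⟩) :
    G.mordellWeilRank = 0 ∧ Nat.card (G.sha ⊓ AddSubgroup.torsionBy G.galH1 3 : AddSubgroup G.galH1) = 1 := by
  have htors : Nat.card (AddSubgroup.torsionBy C.toAffine.Point 3) = 1 := by
    have h := natCard_torsionBy_eq_one_of_hasIrreducibleModPGaloisRep C 3 hirr
    rwa [Nat.cast_ofNat] at h
  have hsC : selmerDimThree C = 1 := by
    rw [selmerDimThree_eq_mordellWeilRank_of_not_three_dvd_shaOrder C hfin h3 htors, hrk]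
  have hsG : selmerDimThree G = 0 := by
    have h := (hJP C G q hq hirr hcong hcls hq3 hqN hN hsplit hTC hTG h0C h0G hw hfin h3).1 hndiv
    omega
  exact ⟨mordellWeilRank_eq_zero_of_selmerDimThree_eq_zero G hsG,
    natCard_shaThreeTorsion_eq_one_of_selmerDimThree_eq_zero G hsG⟩

/-- **Cell `r_C = 1 ∧ DIV ⟹ dim Sel₃(G) = 2` (JPC3: 20/20, read there as `rank G = 0 ∧ 9 ∥ #Ш_an(G)`)** from the DIV
branch of T-O5-JP; with `rank G(ℚ) = 0`, `Ш(G)` finite and `#G(ℚ)[3] = 1` this is `9 ∣ #Ш(G)`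
(`nine_dvd_shaOrder_of_selmerDimThree_eq_two`).  The node enters as the hypothesis `hJP`. [cite: SilvermanAEC2009, Thm. X.4.2] -/
theorem selmerDimThree_eq_two_of_signedTransfer_of_div (hJP : SignedLevelRaisingTransferThree)
    (C G : WeierstrassCurve ℚ) [C.IsElliptic] [C.IsGloballyMinimal] [G.IsElliptic] [G.IsGloballyMinimal]
    (q : ℕ) (hq : q.Prime) (hirr : C.HasIrreducibleModPGaloisRep 3) (hcong : IsCongruentModThree C G)
    (hcls : ClassO5 C 3 ∨ ¬ Addv C 3) (hq3 : q % 3 = 2) (hqN : ¬ (q ∣ C.conductorNorm ℤ))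
    (hN : G.conductorNorm ℤ = C.conductorNorm ℤ * q) (hsplit : @IsSplitNodeAt G q ⟨hq⟩)
    (hTC : transversePrimesThree C = ∅) (hTG : transversePrimesThree G ⊆ {q})
    (h0C : @NoLocalThreeTorsionAt C 3 ⟨Nat.prime_three⟩) (h0G : @NoLocalThreeTorsionAt G 3 ⟨Nat.prime_three⟩)
    (hw : C.rootNumberThree = G.rootNumberThree) (hfin : C.ShaFinite) (h3 : ¬ 3 ∣ C.shaOrder)
    (hrk : C.mordellWeilRank = 1) (hdiv : @LocallyThreeDivisibleAt C q ⟨hq⟩) : selmerDimThree G = 2 := by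
  have htors : Nat.card (AddSubgroup.torsionBy C.toAffine.Point 3) = 1 := by
    have h := natCard_torsionBy_eq_one_of_hasIrreducibleModPGaloisRep C 3 hirr
    rwa [Nat.cast_ofNat] at h
  have hsC : selmerDimThree C = 1 := by
    rw [selmerDimThree_eq_mordellWeilRank_of_not_three_dvd_shaOrder C hfin h3 htors, hrk]
  have h := (hJP C G q hq hirr hcong hcls hq3 hqN hN hsplit hTC hTG h0C h0G hw hfin h3).2 hdiv
  omega

/-- **Cell `r_C = 0 ⟹ dim Sel₃(G) = 1` (JPC3: 306/306, read there as `rank G = 1 ∧ 3 ∤ #Ш_an(G)`)**: at rank `0`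
the DIV branch applies (`locallyThreeDivisibleAt_of_rank_zero`) and `dim Sel₃(C) = 0`; granted Cassels–Tate and
`Ш(G)` finite, `#G(ℚ)[3] = 1`, this is `rank G(ℚ) = 1` (`mordellWeilRank_eq_one_of_selmerDimThree_eq_one`).  The node
enters as the hypothesis `hJP`. [cite: SilvermanAEC2009, Thm. X.4.2] -/
theorem selmerDimThree_eq_one_of_signedTransfer_of_rank_zero (hJP : SignedLevelRaisingTransferThree)
    (C G : WeierstrassCurve ℚ) [C.IsElliptic] [C.IsGloballyMinimal] [G.IsElliptic] [G.IsGloballyMinimal]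
    (q : ℕ) (hq : q.Prime) (hirr : C.HasIrreducibleModPGaloisRep 3) (hcong : IsCongruentModThree C G)
    (hcls : ClassO5 C 3 ∨ ¬ Addv C 3) (hq3 : q % 3 = 2) (hqN : ¬ (q ∣ C.conductorNorm ℤ))
    (hN : G.conductorNorm ℤ = C.conductorNorm ℤ * q) (hsplit : @IsSplitNodeAt G q ⟨hq⟩)
    (hTC : transversePrimesThree C = ∅) (hTG : transversePrimesThree G ⊆ {q})
    (h0C : @NoLocalThreeTorsionAt C 3 ⟨Nat.prime_three⟩) (h0G : @NoLocalThreeTorsionAt G 3 ⟨Nat.prime_three⟩)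
    (hw : C.rootNumberThree = G.rootNumberThree) (hfin : C.ShaFinite) (h3 : ¬ 3 ∣ C.shaOrder)
    (hrk : C.mordellWeilRank = 0) : selmerDimThree G = 1 := by
  have htors : Nat.card (AddSubgroup.torsionBy C.toAffine.Point 3) = 1 := by
    have h := natCard_torsionBy_eq_one_of_hasIrreducibleModPGaloisRep C 3 hirr
    rwa [Nat.cast_ofNat] at h
  have hsC : selmerDimThree C = 0 := by
    rw [selmerDimThree_eq_mordellWeilRank_of_not_three_dvd_shaOrder C hfin h3 htors, hrk]
  have hdiv : @LocallyThreeDivisibleAt C q ⟨hq⟩ :=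
    @locallyThreeDivisibleAt_of_rank_zero C _ q ⟨hq⟩ hrk htors
  have h := (hJP C G q hq hirr hcong hcls hq3 hqN hN hsplit hTC hTG h0C h0G hw hfin h3).2 hdiv
  omega

/-- **T-O5-JP♯ ⟹ T-O5-JP granted the Weil-pairing fact "`q ≡ 2 (mod 3)` ⟹ `h⁰(ℚ_q, C[3]) ≤ 1`"** (full `ℚ_q`-rational
`3`-torsion forces `μ₃ ⊂ ℚ_q`, i.e. `3 ∣ q − 1`; displayed as the hypothesis `hμ`, not a tree theorem for the
polynomial predicate `FullLocalThreeTorsionAt`).  Records that the SHARP node is the stronger one.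
[cite: SilvermanAEC2009, Cor. III.8.1.1] -/
theorem signedLevelRaisingTransferThree_of_sharp (hS : SignedLevelRaisingTransferThreeSharp)
    (hμ : ∀ (C : WeierstrassCurve ℚ) (q : ℕ) (hq : q.Prime), q % 3 = 2 → ¬ @FullLocalThreeTorsionAt C q ⟨hq⟩) :
    SignedLevelRaisingTransferThree := by
  intro C G _ _ _ _ q hq hirr hcong hcls hq3 hqN hN hsplit hTC hTG h0C h0G hw hfin h3
  exact hS C G q hq hirr hcong hcls (by omega) (hμ C q hq hq3) hqN hN hsplit hTC hTG h0C h0G hw hfin h3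

end Summit.BirchSwinnertonDyer.Rank1Residual.O5

end
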